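import Literature.MathematicalPhysics.QuantumLattice.MarkovZeroEntropyCellUBox
import Literature.MathematicalPhysics.QuantumLattice.InfVolFermionStateParticleHole
import HarnessLib

/-!
# The particle–hole reflection `μ ↦ U − μ` of a corner Markov (C1) pressure certificate — at the certificate level,
# every window, every dimension, EVERY torus (no parity condition) — and its readers

Topic `MathematicalPhysics/QuantumLattice`, namespace `Literature.MathematicalPhysics.QuantumLattice`. Family `hubbard`
(pub/hubbard-downfold, seat hubbard-downfold-unc-2 = the FILLING / chemical-potential direction of «a parameter BOX maps to a
certified word»), 2026-08-27.

The free-energy programme (`hubbard-thermal`, certificate C1) certifies Markov pressure CEILINGS of the `t' = 0` Hubbard model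
by a finite matrix inequality on a window `Λ ⊆ ℤ^d` with corner `a`
  `e^c · exp(L_B) − tr_{Λ→Λ∖a} exp(−β (h_μ + G) + Γ L_B) ⪰ 0`,        `h_μ = cornerEnergyRep Λ a t U μ`,
`G = windowAnnihilator …` (zero expectation in translation-invariant states), `L_B ∈ 𝔄_{Λ∖a}` a Hermitian dual
(`HubbardTorusMarkovPressureClusterBound`, `HubbardTorusMarkovClusterPressureTorusLimit`): it yields
`log Z_β(H_L − μN_L) ≤ c L^d + O(L^{d−1})` on every torus `L ≥ 3` and, downstream, the canonical hot anchor
`log Z_β^{sector n} ≤ (c − βμn + ε)L²` of the Markov + zero-entropy temperature cells (`MarkovZeroEntropyCellUBox`).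
A certificate is TUNED to one chemical potential: read in a sector of density `n` far from `n(μ)` the Legendre step
`−βμn` is loose — for the programme's hole-tuned nodes (`μ ≈ 2.18` at `U = 8`) read on the ELECTRON-doped side
(`n ≈ 1.1–1.2`) the loss is `β(U − 2μ)(n − 1) ≈ 0.23` in the ray numerator.

THIS FILE proves that the STAGGERED PARTICLE–HOLE AUTOMORPHISM `α_Λ` (`phAut Λ`, `c_{xσ} ↦ (−1)^{|x|} c†_{xσ}`;
`InfVolFermionStateParticleHole`) maps a certificate at `μ` to a certificate at `U − μ` with THE SAME blocks:
* §1 `α` versus the trace pairing, the fermionic partial trace along an inclusion (`phAut_fermionPartialTrace_incl`: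
  `α_{Λ₀} ∘ tr_{Λ→Λ₀} = tr_{Λ→Λ₀} ∘ α_Λ`), the functional calculus and positivity; the spectral shift
  `exp(A + r) = e^r exp(A)`;
* §2 `phAut_clusterHamiltonian`: bonds are invariant, `n ↦ 1 − n` turns the site potential `μ_x` into `−U V_x − μ_x` and adds the
  constant `U ΣV + 2Σμ`; for the corner representative `α(h_μ) = h_{U−μ} + (U − 2μ)·1` (`phAut_cornerEnergyRep`); and the
  reflected annihilator `α_Λ(G)` has ZERO expectation in the window marginal of every translation-invariant AND EVEN torus
  state (`trace_window_mul_phAut_windowAnnihilator` — odd translates pick up the grading `Θ`, invisible to an even state;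
  this is why no parity condition on the torus and no evenness of the `O_i` is needed);
* §3 THE REFLECTED CERTIFICATE (`cornerCertificate_particleHole`): `(G, L_B, c)` at `μ` ↦ `(α G, α L_B, c + β(U − 2μ))` at `U − μ`;
* §4 readers (square lattice): the eventual canonical hot anchor `(c + β_h(U − 2μ) − β_h(U − μ)n + ε)L²` (any
  `Ls → ∞`; the finite-torus grand-canonical bound at `U − μ` on every `L ≥ 3`, any `d`, is
  `hubbardWith_log_partitionFn_le_of_cornerCertificate` applied to §3 + §2 and is not restated), its `t'`-transport, and
  the Markov + zero-entropy rays (`…_of_hot_left_U…` free above the anchor, kinematic below) with rectangle corollaries in the ∃-shape of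
  the programme's claim nodes. Versus the direct reading the numerator changes by `−β_h(U − 2μ)(n − 1)`: a gain for every
  `n > 1` when `μ < U/2` (and the direct reading remains the better one for `n < 1`).

Everything is PROVED; no definition, no named fact, no number. HONEST SCOPE: an exact symmetry transport of an EXISTING
certificate — no new information about the model (the grand-canonical pressure satisfies `p(β, U − μ) = p(β, μ) + β(U − 2μ)`);
the gain is purely in the Legendre step for electron-doped sectors. WHAT THIS IS NOT: no certificate, no phase sentence.

## Mathlib / tree search

REUSED: `phAut`, `phAut_phAut`, `fermionEmbed_incl_phAut`, `fermionEmbed_shiftEmb_phAut_of_eq_one/_neg_one`, `siteStagger_*`,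
`particleHoleAut_*`, `parityAut_phAut` (`InfVolFermionStateParticleHole`); `fermionPartialTrace`, `trace_mul_fermionPartialTrace`,
`eq_fermionPartialTrace_of_forall_trace_mul`, `trace_mul_parityAut`, `parityAut_fermionPartialTrace_of_even` (`FermionPartialTrace`);
`particleHole_conjTranspose_mul`, `particleHole_mul_conjTranspose`, `norm_intCast_units` (`HubbardModelParticleHoleProofs`);
`Literature.LinearAlgebra.Matrix.conjTranspose_mul_cfc_mul_of_unitary` (`JensenOperatorInequality`); `clusterHamiltonian`,
`clusterBondKinetic`, `siteWeightSum` (`HubbardAndersonClusterBound`); `windowAnnihilator`, `torus_trace_fermionPartialTrace_mul_translate_eq`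
(`HubbardTorusClusterEnergyRepresentative`); `cornerEnergyRep`, `hubbardWith_log_partitionFn_le_of_clusterCertificate`,
`parityAut_hubbardTorusWith` (`HubbardTorusMarkovPressureClusterBound`); `eventually_log_partitionFn_sectorHamiltonianTT'_le_of_clusterCertificate`
(`HubbardTorusMarkovClusterPressureTorusLimit`); `parityAut_gibbsDensity`, `relabel_translate_gibbsDensity` (`TorusMarkovPressureBound`);
`eventually_log_partitionFn_sector_le_of_tPrime_anchor_ceiling` (`TypeClassSidecarReaderTPrimeTransport`);
`IsTorusLimitOfMixture.meanEnergy_hubbardTTPrime_le_of_hot_left_U/_anchorU_kinematic_of_energyDensityTT'_le` (`MarkovZeroEntropyCellUBox`).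
`rg 'phAut.*(cornerEnergyRep|clusterHamiltonian|windowAnnihilator|fermionPartialTrace)|Certificate.*particleHole' Literature` (2026-08-27): nothing.

## References

* E. H. Lieb, Phys. Rev. Lett. 62 (1989) 1201, proof of Theorem 2 (the staggered particle–hole transformation of the Hubbard
  model on a bipartite lattice: hopping invariant, `U n↑n↓ − μn ↦ U n↑n↓ − (U − μ)n + (U − 2μ)`). [cite: LiebPRL1989, proof of Theorem 2]
* H. Tasaki, *Physics and Mathematics of Quantum Many-Body Systems* (2020), §9.3.3. [cite: Tasaki2020, §9.3.3]
* D. Poulin, M. B. Hastings, Phys. Rev. Lett. 106 (2011) 080403, eqs. (3)–(8) (Markov entropy decomposition certificates).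
  [cite: PoulinHastings2011, eqs. (3)–(8)]
* H. Araki, H. Moriya, Rev. Math. Phys. 15 (2003) 93, §4.1 (even states, local algebras, conditional expectations).
  [cite: ArakiMoriya2003, §4.1 Def. 4.5]
* R. B. Israel, *Convexity in the Theory of Lattice Gases* (1979), Thm. I.3.4, Lemma II.3.1. [cite: Israel1979, Lemma II.3.1]
-/

noncomputable section

namespace Literature.MathematicalPhysics.QuantumLattice

open Matrix Finset HubbardWave0 ThermodynamicLimit LiebThm1 AndersonCluster Literature.Probability.LatticeModels
open _root_.Filter
open scoped _root_.Topology ComplexOrder BigOperators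

/-! ### §1 The staggered particle–hole automorphism versus trace, partial trace, functional calculus, positivity -/

section PhAutAlgebra

variable {d : ℕ}

/-- `tr α_Λ(X) = tr X` (`α_Λ` is conjugation by the unitary particle–hole matrix). [cite: Tasaki2020, §9.3.3] -/
theorem trace_phAut {Λ : Finset (Site d)} (X : FermionOp Λ) : (phAut Λ X).trace = X.trace := by
  rw [phAut, particleHoleAut_apply, Matrix.trace_mul_cycle,
    particleHole_conjTranspose_mul _ (fun i => norm_intCast_units _), Matrix.one_mul]

/-- **`α_Λ` is symmetric for the trace pairing**: `tr(A · α X) = tr(α A · X)` (`α` is an involutive `*`-automorphism).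
[cite: Tasaki2020, §9.3.3] -/
theorem trace_mul_phAut {Λ : Finset (Site d)} (A X : FermionOp Λ) :
    (A * phAut Λ X).trace = (phAut Λ A * X).trace := by
  have h := trace_phAut (phAut Λ A * X)
  rw [map_mul, phAut_phAut] at h
  exact h

/-- **`α` commutes with the fermionic partial trace along an inclusion**: `α_{Λ₀}(tr_{Λ→Λ₀} Y) = tr_{Λ→Λ₀}(α_Λ Y)` for
`Λ₀ ⊆ Λ` (the same site carries the same sign in both regions; duality + uniqueness of the partial trace).
[cite: ArakiMoriya2003, §4.1 Def. 4.5] -/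
theorem phAut_fermionPartialTrace_incl {Λ₀ Λ : Finset (Site d)} (h : Λ₀ ⊆ Λ) (Y : FermionOp Λ) :
    phAut Λ₀ (fermionPartialTrace (PolySite.incl h) Y) = fermionPartialTrace (PolySite.incl h) (phAut Λ Y) := by
  refine eq_fermionPartialTrace_of_forall_trace_mul _ _ fun A => ?_
  rw [trace_mul_phAut A, trace_mul_fermionPartialTrace, fermionEmbed_incl_phAut, ← trace_mul_phAut]

/-- `α_Λ` preserves positive semidefiniteness (`α X = P X Pᴴ`). [cite: Tasaki2020, §9.3.3] -/
theorem posSemidef_phAut {Λ : Finset (Site d)} {X : FermionOp Λ} (hX : X.PosSemidef) : (phAut Λ X).PosSemidef := by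
  rw [phAut, particleHoleAut_apply]
  exact hX.mul_mul_conjTranspose_same _

/-- `α_Λ` preserves Hermiticity. [cite: Tasaki2020, §9.3.3] -/
theorem isHermitian_phAut {Λ : Finset (Site d)} {X : FermionOp Λ} (hX : X.IsHermitian) : (phAut Λ X).IsHermitian := by
  unfold Matrix.IsHermitian
  rw [← phAut_conjTranspose, hX.eq]

/-- **`α_Λ` commutes with the real functional calculus** of a Hermitian element: `α(f(M)) = f(α M)` (unitary covariance of
`cfc`). [cite: Tasaki2020, §9.3.3] -/
theorem phAut_cfc {Λ : Finset (Site d)} {M : FermionOp Λ} (hM : M.IsHermitian) (f : ℝ → ℝ) :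
    phAut Λ (cfc f M) = cfc f (phAut Λ M) := by
  set P : FermionOp Λ := particleHole (fun i => (((phSign Λ i : ℤˣ) : ℤ) : ℂ)) with hP
  have hPP : P * Pᴴ = 1 := particleHole_mul_conjTranspose _ (fun i => norm_intCast_units _)
  have h1 : phAut Λ (cfc f M) = P * cfc f M * Pᴴ := particleHoleAut_apply _ _
  have h2 : phAut Λ M = P * M * Pᴴ := particleHoleAut_apply _ _
  have hU : (Pᴴ)ᴴ * Pᴴ = 1 := by rw [conjTranspose_conjTranspose, hPP]
  have h3 := Literature.LinearAlgebra.Matrix.conjTranspose_mul_cfc_mul_of_unitary (Pᴴ) hU hM f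
  rw [conjTranspose_conjTranspose] at h3
  rw [h1, h2, h3]

/-- **Spectral shift of the exponential**: `exp(A + r·1) = e^r · exp(A)` for Hermitian `A` and real `r` (continuous functional
calculus: composition with the translation `x ↦ x + r`). [cite: ReedSimonI1980, Theorem VII.1] -/
theorem cfc_exp_add_smul_one {m : Type*} [Fintype m] [DecidableEq m] {A : Matrix m m ℂ} (hA : A.IsHermitian) (r : ℝ) :
    cfc Real.exp (A + (r : ℂ) • (1 : Matrix m m ℂ)) = (Real.exp r : ℂ) • cfc Real.exp A := by
  have hA' : IsSelfAdjoint A := hA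
  have h1 : cfc (fun x : ℝ => x + r) A = A + (r : ℂ) • (1 : Matrix m m ℂ) := by
    rw [cfc_add A (fun x : ℝ => x) (fun _ : ℝ => r), cfc_id' ℝ A, cfc_const r A, Algebra.algebraMap_eq_smul_one]
    rfl
  have h2 : cfc Real.exp (A + (r : ℂ) • (1 : Matrix m m ℂ)) = cfc (fun x : ℝ => Real.exp (x + r)) A := by
    rw [← h1, ← cfc_comp' Real.exp (fun x : ℝ => x + r) A]
  have h3 : (fun x : ℝ => Real.exp (x + r)) = fun x : ℝ => Real.exp r * Real.exp x := by
    funext x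
    rw [Real.exp_add, mul_comm]
  rw [h2, h3, cfc_const_mul (Real.exp r) Real.exp A, RCLike.real_smul_eq_coe_smul (K := ℂ)]
  rfl

end PhAutAlgebra

/-! ### §2 The reflected cluster Hamiltonian, corner representative and annihilator -/

section Cluster

variable {d : ℕ}

/-- `α_Λ(n_{yσ}) = 1 − n_{yσ}`. [cite: LiebPRL1989, proof of Theorem 2] -/
theorem phAut_numberOp {Λ : Finset (Site d)} (y : PolySite Λ) (σ : Fin 2) :
    phAut Λ (numberOp y σ) = 1 - numberOp y σ :=
  particleHoleAut_numberAt (phSign Λ) (orb y σ)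

/-- The unimodular staggering signs square to one in `ℂ`: `ε_x · ε_x = 1`. [cite: LiebPRL1989, proof of Theorem 2] -/
private theorem stagger_mul_self (x : Site d) :
    (((siteStagger x : ℤˣ) : ℤ) : ℂ) * (((siteStagger x : ℤˣ) : ℤ) : ℂ) = 1 := by
  rw [← Int.cast_mul, ← Units.val_mul, Int.units_mul_self, Units.val_one, Int.cast_one]

/-- **The window bond terms are particle–hole invariant**: `α_Λ(Σ_σ (c†_x c_{x+eᵢ} + h.c.)) = Σ_σ (c†_x c_{x+eᵢ} + h.c.)`
(neighbouring sites carry opposite staggering signs). [cite: LiebPRL1989, proof of Theorem 2] -/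
theorem phAut_clusterBondKinetic (Λ : Finset (Site d)) (y : PolySite Λ) (i : Fin d) :
    phAut Λ (clusterBondKinetic Λ y i) = clusterBondKinetic Λ y i := by
  unfold clusterBondKinetic
  split_ifs with h
  · rw [map_sum]
    refine Finset.sum_congr rfl fun σ _ => ?_
    have hne : orb y σ ≠ orb (PolySite.pt (ofLex y.1 + unitVec i) h) σ := by
      intro heq
      have := congrArg (fun o : Orb (PolySite Λ) => ofLex ((ofLex o).1 : PolySite Λ).1) heq
      exact self_ne_add_unitVec (ofLex y.1) i this
    have hsgn : (((phSign Λ (orb y σ) : ℤˣ) : ℤ) : ℂ) *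
        (((phSign Λ (orb (PolySite.pt (ofLex y.1 + unitVec i) h) σ) : ℤˣ) : ℤ) : ℂ) = -1 := by
      rw [phSign_orb, phSign_orb_pt, show ofLex y.1 + unitVec i = ofLex y.1 + Pi.single i (1 : ℤ) from rfl,
        siteStagger_add_single_one, Units.val_neg, Int.cast_neg, mul_neg, stagger_mul_self]
    rw [map_add, map_mul, map_mul, phAut, particleHoleAut_creation, particleHoleAut_annihilation,
      particleHoleAut_creation, particleHoleAut_annihilation, Matrix.smul_mul, Matrix.mul_smul, smul_smul, hsgn,
      Matrix.smul_mul, Matrix.mul_smul, smul_smul, mul_comm, hsgn, annihilation_mul_creation, if_neg hne,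
      annihilation_mul_creation, if_neg (Ne.symm hne), zero_sub, zero_sub, neg_smul, neg_smul, one_smul, one_smul,
      neg_neg, neg_neg, add_comm]
  · rw [map_zero]

/-- Sums over the ordered site set `PolySite Λ` are sums over the region `Λ` (local copy; the tree's is private). [folklore] -/
private theorem PolySite.sum_ofLex_eq' {M : Type*} [AddCommMonoid M] (Λ : Finset (Site d)) (f : Site d → M) :
    ∑ y : PolySite Λ, f (ofLex y.1) = ∑ x ∈ Λ, f x := by
  conv_rhs => rw [← map_univ_polySiteEmb Λ, Finset.sum_map]
  rfl

/-- **The particle–hole reflection of a weighted cluster Hamiltonian** (`t' = 0`, any weights): bonds are invariant and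
`n_{yσ} ↦ 1 − n_{yσ}` gives
`α_Λ(h(J, V, μ)) = h(J, V, x ↦ −U V_x − μ_x) + (U ΣV + 2 Σμ)·1`. [cite: LiebPRL1989, proof of Theorem 2] -/
theorem phAut_clusterHamiltonian (Λ : Finset (Site d)) (t U : ℝ) (J : Site d → Fin d → ℝ) (V μ : Site d → ℝ) :
    phAut Λ (clusterHamiltonian Λ t U J V μ) =
      clusterHamiltonian Λ t U J V (fun x => -(U * V x) - μ x) +
        ((U * siteWeightSum Λ V + 2 * siteWeightSum Λ μ : ℝ) : ℂ) • (1 : FermionOp Λ) := by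
  -- per-site identities
  have h1 : ∀ y : PolySite Λ, ((V (ofLex y.1) : ℝ) : ℂ) • ((1 - numberOp y 0) * (1 - numberOp y 1)) =
      ((V (ofLex y.1) : ℝ) : ℂ) • (numberOp y 0 * numberOp y 1) - ((V (ofLex y.1) : ℝ) : ℂ) • (numberOp y 0 + numberOp y 1) +
        ((V (ofLex y.1) : ℝ) : ℂ) • (1 : FermionOp Λ) := fun y => by
    rw [← smul_sub, ← smul_add]
    congr 1
    noncomm_ring
  have h2 : ∀ y : PolySite Λ, ((μ (ofLex y.1) : ℝ) : ℂ) • ((1 - numberOp y 0) + (1 - numberOp y 1)) =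
      -(((μ (ofLex y.1) : ℝ) : ℂ) • (numberOp y 0 + numberOp y 1)) +
        ((μ (ofLex y.1) : ℝ) : ℂ) • ((2 : ℂ) • (1 : FermionOp Λ)) := fun y => by
    rw [← smul_neg, ← smul_add]
    congr 1
    rw [two_smul]
    abel
  have h3 : ∀ y : PolySite Λ, ((-(U * V (ofLex y.1)) - μ (ofLex y.1) : ℝ) : ℂ) • (numberOp y 0 + numberOp y 1) =
      -((U : ℂ) • (((V (ofLex y.1) : ℝ) : ℂ) • (numberOp y 0 + numberOp y 1))) -
        ((μ (ofLex y.1) : ℝ) : ℂ) • (numberOp y 0 + numberOp y 1) := fun y => by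
    rw [smul_smul, ← neg_smul, ← sub_smul]
    push_cast
    ring_nf
  have hsumV : (∑ y : PolySite Λ, ((V (ofLex y.1) : ℝ) : ℂ)) = ((siteWeightSum Λ V : ℝ) : ℂ) := by
    push_cast [siteWeightSum]
    exact PolySite.sum_ofLex_eq' Λ (fun x => ((V x : ℝ) : ℂ))
  have hsumμ : (∑ y : PolySite Λ, ((μ (ofLex y.1) : ℝ) : ℂ)) = ((siteWeightSum Λ μ : ℝ) : ℂ) := by
    push_cast [siteWeightSum]
    exact PolySite.sum_ofLex_eq' Λ (fun x => ((μ x : ℝ) : ℂ))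
  have hV : (∑ y : PolySite Λ, ((V (ofLex y.1) : ℝ) : ℂ) • ((1 - numberOp y 0) * (1 - numberOp y 1))) =
      (∑ y : PolySite Λ, ((V (ofLex y.1) : ℝ) : ℂ) • (numberOp y 0 * numberOp y 1)) -
        (∑ y : PolySite Λ, ((V (ofLex y.1) : ℝ) : ℂ) • (numberOp y 0 + numberOp y 1)) +
          ((siteWeightSum Λ V : ℝ) : ℂ) • (1 : FermionOp Λ) := by
    simp_rw [h1]
    rw [Finset.sum_add_distrib, Finset.sum_sub_distrib, ← Finset.sum_smul, hsumV]
  have hM : (∑ y : PolySite Λ, ((μ (ofLex y.1) : ℝ) : ℂ) • ((1 - numberOp y 0) + (1 - numberOp y 1))) =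
      -(∑ y : PolySite Λ, ((μ (ofLex y.1) : ℝ) : ℂ) • (numberOp y 0 + numberOp y 1)) +
        ((siteWeightSum Λ μ : ℝ) : ℂ) • ((2 : ℂ) • (1 : FermionOp Λ)) := by
    simp_rw [h2]
    rw [Finset.sum_add_distrib, Finset.sum_neg_distrib, ← Finset.sum_smul, hsumμ]
  have hR : (∑ y : PolySite Λ, ((-(U * V (ofLex y.1)) - μ (ofLex y.1) : ℝ) : ℂ) • (numberOp y 0 + numberOp y 1)) =
      -((U : ℂ) • ∑ y : PolySite Λ, ((V (ofLex y.1) : ℝ) : ℂ) • (numberOp y 0 + numberOp y 1)) -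
        ∑ y : PolySite Λ, ((μ (ofLex y.1) : ℝ) : ℂ) • (numberOp y 0 + numberOp y 1) := by
    simp_rw [h3]
    rw [Finset.sum_sub_distrib, Finset.sum_neg_distrib, ← Finset.smul_sum]
  unfold clusterHamiltonian
  simp only [map_add, map_smul, map_sum, map_mul, phAut_clusterBondKinetic, phAut_numberOp]
  rw [hV, hM, hR]
  push_cast
  module

/-- **The particle–hole reflection of the corner energy representative**: for `a ∈ Λ`,
`α_Λ(h_μ) = h_{U−μ} + (U − 2μ)·1` (`h_μ = U n_{a↑}n_{a↓} − μ n_a − t Σ_i hop(a − eᵢ, a)`).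
[cite: LiebPRL1989, proof of Theorem 2] -/
theorem phAut_cornerEnergyRep {Λ : Finset (Site d)} {a : Site d} (ha : a ∈ Λ) (t U μ : ℝ) :
    phAut Λ (cornerEnergyRep Λ a t U μ) =
      cornerEnergyRep Λ a t U (U - μ) + ((U - 2 * μ : ℝ) : ℂ) • (1 : FermionOp Λ) := by
  rw [cornerEnergyRep, cornerEnergyRep, phAut_clusterHamiltonian, siteWeightSum_cornerSiteWeight ha,
    siteWeightSum_mul_cornerSiteWeight ha (-μ)]
  have hfun : (fun x => -(U * cornerSiteWeight a x) - -μ * cornerSiteWeight a x) =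
      fun x => -(U - μ) * cornerSiteWeight a x := by
    funext x
    ring
  rw [hfun, show U * 1 + 2 * -μ = U - 2 * μ by ring]

variable {L : ℕ} [NeZero L]

/-- **The reflected annihilator has zero expectation in every translation-invariant EVEN torus state**:
`tr(ρ_Λ · α_Λ(G)) = 0` for `G = Σ_i g_i (Γ O_i − Γ τ_{z_i} O_i)`, `ρ_Λ = tr_{𝕋→Λ} ρ`, `Λ` fitting into the torus, `ρ`
translation invariant and even — with NO parity hypothesis on the local operators `O_i` and none on the torus side:
`α_Λ(Γ O_i − Γ τ_z O_i) = Γ(α O_i) − Θ^{|z|} Γ τ_z (α O_i)`, and an even state does not see `Θ`.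
[cite: ArakiMoriya2003, §4.1 Def. 4.5] [cite: LiebPRL1989, proof of Theorem 2] -/
theorem trace_window_mul_phAut_windowAnnihilator
    {ρ : Matrix (Finset (Orb (FermionTorus d L))) (Finset (Orb (FermionTorus d L))) ℂ}
    (hTI : ∀ w : TorusSite d L, relabel (Orb.translate w) ρ = ρ) (hev : parityAut ρ = ρ)
    {Λ : Finset (Site d)} (hΩ : Set.InjOn (Torus.proj (d := d) L) ↑Λ)
    {ι : Type*} (s : Finset ι) (S : ι → Finset (Site d)) (hS : ∀ i, S i ⊆ Λ) (z : ι → Site d)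
    (hz : ∀ i, shiftSet (z i) (S i) ⊆ Λ) (O : ∀ i, FermionOp (S i)) (g : ι → ℝ) :
    (fermionPartialTrace (PolySite.toTorusEmb L hΩ) ρ * phAut Λ (windowAnnihilator s Λ S hS z hz O g)).trace = 0 := by
  have hevΛ : parityAut (fermionPartialTrace (PolySite.toTorusEmb L hΩ) ρ) =
      fermionPartialTrace (PolySite.toTorusEmb L hΩ) ρ :=
    parityAut_fermionPartialTrace_of_even _ hev
  unfold windowAnnihilator
  rw [map_sum, Matrix.mul_sum, Matrix.trace_sum]
  refine Finset.sum_eq_zero fun i _ => ?_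
  rw [map_smul, Matrix.mul_smul, Matrix.trace_smul, map_sub, Matrix.mul_sub, Matrix.trace_sub,
    ← fermionEmbed_incl_phAut (hS i), ← fermionEmbed_incl_phAut (hz i)]
  rcases siteStagger_eq_one_or (z i) with h1 | h1
  · rw [← fermionEmbed_shiftEmb_phAut_of_eq_one h1,
      torus_trace_fermionPartialTrace_mul_translate_eq hTI hΩ (hS i) (z i) (hz i), sub_self, smul_zero]
  · have key : phAut (shiftSet (z i) (S i)) (fermionEmbed (PolySite.shiftEmb (z i) (S i)) (O i)) =
        parityAut (fermionEmbed (PolySite.shiftEmb (z i) (S i)) (phAut (S i) (O i))) := by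
      have h := fermionEmbed_shiftEmb_phAut_of_eq_neg_one h1 (parityAut (O i))
      rw [← parityAut_phAut (O i), fermionEmbed_parityAut, fermionEmbed_parityAut, parityAut_parityAut] at h
      exact h.symm
    rw [key, fermionEmbed_parityAut, trace_mul_parityAut, hevΛ,
      torus_trace_fermionPartialTrace_mul_translate_eq hTI hΩ (hS i) (z i) (hz i), sub_self, smul_zero]

end Cluster

/-! ### §3 The reflected certificate: `(G, L_B, c)` at `μ` ↦ `(α G, α L_B, c + β(U − 2μ))` at `U − μ` -/

section Certificate

variable {d : ℕ}

/-- The exponent of a certificate, `−β(h + G) + Γ(L_B)`, is Hermitian. [cite: PoulinHastings2011, eqs. (3)–(8)] -/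
theorem isHermitian_certExponent {Λ : Finset (Site d)} {a : Site d} (β : ℝ) {h G : FermionOp Λ}
    (hh : h.IsHermitian) (hG : G.IsHermitian) {LB : FermionOp (Λ.erase a)} (hLB : LB.IsHermitian) :
    (-((β : ℂ) • (h + G)) + fermionEmbed (PolySite.incl (Finset.erase_subset a Λ)) LB).IsHermitian := by
  refine (isHermitian_real_smul (hh.add hG) β).neg.add ?_
  unfold Matrix.IsHermitian
  rw [← fermionEmbed_conjTranspose, hLB.eq]

/-- **THE PARTICLE–HOLE REFLECTION OF A CORNER MARKOV CERTIFICATE** (`t' = 0`, any window `Λ ∋ a`, any `d`, any Hermitian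
`G`, `L_B`): if `e^c · exp(L_B) − tr_{Λ→Λ∖a} exp(−β (h_μ + G) + Γ L_B) ⪰ 0`, then with `α = phAut`
`e^{c + β(U − 2μ)} · exp(α L_B) − tr_{Λ→Λ∖a} exp(−β (h_{U−μ} + α G) + Γ (α L_B)) ⪰ 0`
(apply the unitary conjugation `α_{Λ∖a}`; it commutes with the partial trace, the functional calculus and `Γ`;
`α(h_μ) = h_{U−μ} + (U − 2μ)` shifts the exponent by a constant). SAME blocks, reflected.
[cite: LiebPRL1989, proof of Theorem 2] [cite: PoulinHastings2011, eqs. (3)–(8)] -/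
theorem cornerCertificate_particleHole {Λ : Finset (Site d)} {a : Site d} (ha : a ∈ Λ) (t U μ β : ℝ)
    {G : FermionOp Λ} (hG : G.IsHermitian) {LB : FermionOp (Λ.erase a)} (hLB : LB.IsHermitian) {c : ℝ}
    (hcert : ((Real.exp c : ℂ) • cfc Real.exp LB -
      fermionPartialTrace (PolySite.incl (Finset.erase_subset a Λ))
        (cfc Real.exp (-((β : ℂ) • (cornerEnergyRep Λ a t U μ + G)) +
          fermionEmbed (PolySite.incl (Finset.erase_subset a Λ)) LB))).PosSemidef) :
    ((Real.exp (c + β * (U - 2 * μ)) : ℂ) • cfc Real.exp (phAut (Λ.erase a) LB) -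
      fermionPartialTrace (PolySite.incl (Finset.erase_subset a Λ))
        (cfc Real.exp (-((β : ℂ) • (cornerEnergyRep Λ a t U (U - μ) + phAut Λ G)) +
          fermionEmbed (PolySite.incl (Finset.erase_subset a Λ)) (phAut (Λ.erase a) LB)))).PosSemidef := by
  have hW := isHermitian_certExponent (a := a) β (isHermitian_cornerEnergyRep Λ a t U μ) hG hLB
  have hW' := isHermitian_certExponent (a := a) β (isHermitian_cornerEnergyRep Λ a t U (U - μ)) (isHermitian_phAut hG)
    (isHermitian_phAut hLB)
  have h1 := posSemidef_phAut (Λ := Λ.erase a) hcert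
  rw [map_sub, map_smul, phAut_cfc hLB, phAut_fermionPartialTrace_incl, phAut_cfc hW, map_add, map_neg, map_smul,
    map_add, phAut_cornerEnergyRep ha, ← fermionEmbed_incl_phAut] at h1
  have heq : -((β : ℂ) • (cornerEnergyRep Λ a t U (U - μ) + ((U - 2 * μ : ℝ) : ℂ) • (1 : FermionOp Λ) + phAut Λ G)) +
        fermionEmbed (PolySite.incl (Finset.erase_subset a Λ)) (phAut (Λ.erase a) LB) =
      (-((β : ℂ) • (cornerEnergyRep Λ a t U (U - μ) + phAut Λ G)) +
        fermionEmbed (PolySite.incl (Finset.erase_subset a Λ)) (phAut (Λ.erase a) LB)) +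
        ((-(β * (U - 2 * μ)) : ℝ) : ℂ) • (1 : FermionOp Λ) := by
    push_cast
    module
  rw [heq, cfc_exp_add_smul_one hW', map_smul] at h1
  -- multiply by `e^{β(U − 2μ)} > 0`
  have hpos : (0 : ℂ) ≤ ((Real.exp (β * (U - 2 * μ)) : ℝ) : ℂ) := Complex.zero_le_real.2 (Real.exp_pos _).le
  have h2 := h1.smul hpos
  rw [smul_sub, smul_smul, smul_smul, ← Complex.ofReal_mul, ← Complex.ofReal_mul, ← Real.exp_add, ← Real.exp_add,
    add_neg_cancel, Real.exp_zero, Complex.ofReal_one, one_smul, add_comm (β * (U - 2 * μ)) c] at h2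
  exact h2

end Certificate

/-! ### §4 Readers (square lattice): the eventual canonical hot anchor at `U − μ`, its `t'`-transport, the rays -/

namespace InfVolFermionState

variable {t t' U n β : ℝ} {ω : InfVolFermionState 2} {Ls : ℕ → ℕ}

/-- **The REFLECTED hot anchor** (`d = 2`, `t' = 0`): from a corner Markov certificate at `(β_h, μ, U₁)` with structured
annihilator, for every density `0 ≤ n ≤ 2`, every `Ls → ∞` and every `ε > 0`, eventually
`log Z_{β_h}(H_{Ls j}(t, 0, U₁)|_{sector n}) ≤ ((c + β_h(U₁ − 2μ)) − β_h(U₁ − μ) n + ε)(Ls j)²` — the Legendre step taken at the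
REFLECTED chemical potential `U₁ − μ` (versus the direct reading: `−β_h(U₁ − 2μ)(n − 1)`, a gain for `n > 1` when `μ < U₁/2`).
[cite: PoulinHastings2011, eqs. (3)–(8)] [cite: LiebPRL1989, proof of Theorem 2] [cite: Ruelle1969, §3.4] -/
theorem eventually_log_partitionFn_sector_le_of_cornerMarkovCertificate_particleHole (hn0 : 0 ≤ n) (hn2 : n ≤ 2)
    (t U₁ : ℝ) (βh : ℝ) (hLs : Tendsto Ls atTop atTop)
    (μ : ℝ) {Λ : Finset (Site 2)} {x₀ : Site 2} (hx₀ : x₀ ∈ Λ) (hmax : ∀ y ∈ Λ, toLex y ≤ toLex x₀)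
    (hcorner : ∀ i : Fin 2, x₀ - unitVec i ∈ Λ) {ℓw : ℕ} (hΛ : Λ ⊆ halfOpenBox 2 ℓw)
    {ι : Type*} (sι : Finset ι) (Sw : ι → Finset (Site 2)) (hS : ∀ i, Sw i ⊆ Λ) (zw : ι → Site 2)
    (hzw : ∀ i, shiftSet (zw i) (Sw i) ⊆ Λ) {O : ∀ i, FermionOp (Sw i)} (hO : ∀ i ∈ sι, (O i).IsHermitian)
    (g : ι → ℝ) {LB : FermionOp (Λ.erase x₀)} (hLB : LB.IsHermitian) {c : ℝ}
    (hcert : ((Real.exp c : ℂ) • cfc Real.exp LB -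
      fermionPartialTrace (PolySite.incl (Finset.erase_subset x₀ Λ))
        (cfc Real.exp (-((βh : ℂ) • (cornerEnergyRep Λ x₀ t U₁ μ + windowAnnihilator sι Λ Sw hS zw hzw O g)) +
          fermionEmbed (PolySite.incl (Finset.erase_subset x₀ Λ)) LB))).PosSemidef) :
    ∀ ε : ℝ, 0 < ε → ∀ᶠ j in atTop,
      Real.log (partitionFn βh (sectorHamiltonianTT' t 0 U₁ n (Ls j))).re ≤
        (((c + βh * (U₁ - 2 * μ)) - βh * (U₁ - μ) * n) + ε) * (Ls j : ℝ) ^ 2 := by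
  intro ε hε
  have hGh : (windowAnnihilator sι Λ Sw hS zw hzw O g).IsHermitian := isHermitian_windowAnnihilator sι Λ Sw hS zw hzw hO g
  have hK : ∀ (L : ℕ), hubbardTorusTT' L t 0 U₁ - ((U₁ - μ : ℝ) : ℂ) • totalNumber = hubbardTorusWith 2 L t U₁ (U₁ - μ) :=
    fun L => hubbardTorusTT'_zero_sub_mu t U₁ (U₁ - μ)
  refine eventually_log_partitionFn_sectorHamiltonianTT'_le_of_clusterCertificate t U₁ (U₁ - μ) βh hn0 hn2 hLs hx₀ hmax hΛ
    (fun i => bondWeightSum_cornerBondWeight hx₀ (hcorner i)) (siteWeightSum_cornerSiteWeight hx₀)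
    (siteWeightSum_mul_cornerSiteWeight hx₀ (-(U₁ - μ))) (isHermitian_phAut hGh) (fun L _ hL3 hℓL => ?_)
    (isHermitian_phAut hLB) (cornerCertificate_particleHole hx₀ t U₁ μ βh hGh hLB hcert) hε
  have hKTI : ∀ w : TorusSite 2 L, relabel (Orb.translate w) (hubbardTorusTT' L t 0 U₁ - ((U₁ - μ : ℝ) : ℂ) • totalNumber) =
      hubbardTorusTT' L t 0 U₁ - ((U₁ - μ : ℝ) : ℂ) • totalNumber := fun w => by
    rw [hK, relabel_translate_hubbardTorusWith]
  have hKev : parityAut (hubbardTorusTT' L t 0 U₁ - ((U₁ - μ : ℝ) : ℂ) • totalNumber) =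
      hubbardTorusTT' L t 0 U₁ - ((U₁ - μ : ℝ) : ℂ) • totalNumber := by
    rw [hK, parityAut_hubbardTorusWith]
  exact trace_window_mul_phAut_windowAnnihilator (relabel_translate_gibbsDensity L hKTI βh)
    (parityAut_gibbsDensity L hKev βh) _ sι Sw hS zw hzw O g

/-- **The reflected hot anchor transported along `t'`** (kinematic price `β_h |t'| 16/π²`): for every `ε > 0` eventually
`log Z_{β_h}(H_{Ls j}(t, t', U₁)|_{sector n}) ≤ ((c + β_h(U₁ − 2μ)) − β_h(U₁ − μ) n + β_h |t'| 16/π² + ε)(Ls j)²` (`0 ≤ n < 2`, `β_h > 0`).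
[cite: PoulinHastings2011, eqs. (3)–(8)] [cite: LiebPRL1989, proof of Theorem 2] [cite: Lieb1973, §V (5.2)–(5.4)] -/
theorem eventually_log_partitionFn_sector_le_of_cornerMarkovCertificate_particleHole_tPrimeTransport (hn0 : 0 ≤ n)
    (hn2 : n < 2) (t t' U₁ : ℝ) {βh : ℝ} (hβh : 0 < βh) (hLs : Tendsto Ls atTop atTop)
    (μ : ℝ) {Λ : Finset (Site 2)} {x₀ : Site 2} (hx₀ : x₀ ∈ Λ) (hmax : ∀ y ∈ Λ, toLex y ≤ toLex x₀)
    (hcorner : ∀ i : Fin 2, x₀ - unitVec i ∈ Λ) {ℓw : ℕ} (hΛ : Λ ⊆ halfOpenBox 2 ℓw)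
    {ι : Type*} (sι : Finset ι) (Sw : ι → Finset (Site 2)) (hS : ∀ i, Sw i ⊆ Λ) (zw : ι → Site 2)
    (hzw : ∀ i, shiftSet (zw i) (Sw i) ⊆ Λ) {O : ∀ i, FermionOp (Sw i)} (hO : ∀ i ∈ sι, (O i).IsHermitian)
    (g : ι → ℝ) {LB : FermionOp (Λ.erase x₀)} (hLB : LB.IsHermitian) {c : ℝ}
    (hcert : ((Real.exp c : ℂ) • cfc Real.exp LB -
      fermionPartialTrace (PolySite.incl (Finset.erase_subset x₀ Λ))
        (cfc Real.exp (-((βh : ℂ) • (cornerEnergyRep Λ x₀ t U₁ μ + windowAnnihilator sι Λ Sw hS zw hzw O g)) +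
          fermionEmbed (PolySite.incl (Finset.erase_subset x₀ Λ)) LB))).PosSemidef) :
    ∀ ε : ℝ, 0 < ε → ∀ᶠ j in atTop,
      Real.log (partitionFn βh (sectorHamiltonianTT' t t' U₁ n (Ls j))).re ≤
        ((((c + βh * (U₁ - 2 * μ)) - βh * (U₁ - μ) * n) + βh * |t'| * (16 / Real.pi ^ 2)) + ε) * (Ls j : ℝ) ^ 2 := by
  have hu := eventually_log_partitionFn_sector_le_of_tPrime_anchor_ceiling hn0 hn2 t U₁ hβh 0 t' hLs
    (eventually_log_partitionFn_sector_le_of_cornerMarkovCertificate_particleHole hn0 hn2.le t U₁ βh hLs μ hx₀ hmax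
      hcorner hΛ sι Sw hS zw hzw hO g hLB hcert)
  rw [sub_zero] at hu
  exact hu

/-- **Reflected cold ray, FREE above the anchor** (`t'` arbitrary, `U₁ ≤ U`): `ω` a torus limit of the canonical sector Gibbs
states at `(β, t, t', U, n)` (`U ≥ 0`, `0 ≤ n < 2`, `0 < β_h < β`), a corner certificate at `(β_h, μ, U₁)` (`t' = 0`) and a
`T = 0` row `e(t, t', U, n) ≤ e⁺` give
`e_Φ(ω) ≤ (((c + β_h(U₁ − 2μ)) − β_h(U₁ − μ)n) + β_h |t'| 16/π² + β e⁺)/(β − β_h)`.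
[cite: PoulinHastings2011, eqs. (3)–(8)] [cite: LiebPRL1989, proof of Theorem 2] [cite: Israel1979, Lemma II.3.1]
[cite: GustafsonSigal2003, §18.3 Theorem 18.10] [cite: Lieb1973, §V (5.2)–(5.4)] -/
theorem IsTorusLimitOfMixture.meanEnergy_hubbardTTPrime_le_of_cornerMarkovCertificate_particleHole_tPrimeTransport_left_U_of_energyDensityTT'_le
    (hU0 : 0 ≤ U) (hn0 : 0 ≤ n) (hn2 : n < 2) {U₁ : ℝ} (hU1 : U₁ ≤ U)
    (h : ω.IsTorusLimitOfMixture (sectorGibbsCount n) (fun L => sectorGibbsWeightTT' β t t' U n L)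
      (fun L => sectorGibbsVectorTT' t t' U n L) Ls)
    (hLs : Tendsto Ls atTop atTop) {βh : ℝ} (hβh : 0 < βh) (hlt : βh < β)
    (μ : ℝ) {Λ : Finset (Site 2)} {x₀ : Site 2} (hx₀ : x₀ ∈ Λ) (hmax : ∀ y ∈ Λ, toLex y ≤ toLex x₀)
    (hcorner : ∀ i : Fin 2, x₀ - unitVec i ∈ Λ) {ℓw : ℕ} (hΛ : Λ ⊆ halfOpenBox 2 ℓw)
    {ι : Type*} (sι : Finset ι) (Sw : ι → Finset (Site 2)) (hS : ∀ i, Sw i ⊆ Λ) (zw : ι → Site 2)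
    (hzw : ∀ i, shiftSet (zw i) (Sw i) ⊆ Λ) {O : ∀ i, FermionOp (Sw i)} (hO : ∀ i ∈ sι, (O i).IsHermitian)
    (g : ι → ℝ) {LB : FermionOp (Λ.erase x₀)} (hLB : LB.IsHermitian) {c : ℝ}
    (hcert : ((Real.exp c : ℂ) • cfc Real.exp LB -
      fermionPartialTrace (PolySite.incl (Finset.erase_subset x₀ Λ))
        (cfc Real.exp (-((βh : ℂ) • (cornerEnergyRep Λ x₀ t U₁ μ + windowAnnihilator sι Λ Sw hS zw hzw O g)) +
          fermionEmbed (PolySite.incl (Finset.erase_subset x₀ Λ)) LB))).PosSemidef)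
    {eup : ℝ} (he : energyDensityTT' t t' U n ≤ eup) :
    ω.meanEnergy (hubbardTTPrimeFermionInteraction t t' U) 1 ≤
      ((((c + βh * (U₁ - 2 * μ)) - βh * (U₁ - μ) * n) + βh * |t'| * (16 / Real.pi ^ 2)) + β * eup) / (β - βh) :=
  h.meanEnergy_hubbardTTPrime_le_of_hot_left_U_of_energyDensityTT'_le hU0 hn0 hn2 hU1 hLs hβh hlt
    (eventually_log_partitionFn_sector_le_of_cornerMarkovCertificate_particleHole_tPrimeTransport hn0 hn2 t t' U₁ hβh hLs μ
      hx₀ hmax hcorner hΛ sι Sw hS zw hzw hO g hLB hcert) he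

/-- **Reflected cold ray from ONE anchor `U₀`, kinematic docc price below it**:
`e_Φ(ω) ≤ (((c + β_h(U₀ − 2μ)) − β_h(U₀ − μ)n) + β_h |t'| 16/π² + β_h·max(U₀ − U, 0)·n/2 + β e⁺)/(β − β_h)`.
[cite: PoulinHastings2011, eqs. (3)–(8)] [cite: LiebPRL1989, proof of Theorem 2] [cite: Lieb1973, §V (5.2)–(5.4)]
[cite: Israel1979, Lemma II.3.1] [cite: GustafsonSigal2003, §18.3 Theorem 18.10] -/
theorem IsTorusLimitOfMixture.meanEnergy_hubbardTTPrime_le_of_cornerMarkovCertificate_particleHole_tPrimeTransport_anchorU_kinematic_of_energyDensityTT'_le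
    (hU0 : 0 ≤ U) (hn0 : 0 ≤ n) (hn2 : n < 2) (U₀ : ℝ)
    (h : ω.IsTorusLimitOfMixture (sectorGibbsCount n) (fun L => sectorGibbsWeightTT' β t t' U n L)
      (fun L => sectorGibbsVectorTT' t t' U n L) Ls)
    (hLs : Tendsto Ls atTop atTop) {βh : ℝ} (hβh : 0 < βh) (hlt : βh < β)
    (μ : ℝ) {Λ : Finset (Site 2)} {x₀ : Site 2} (hx₀ : x₀ ∈ Λ) (hmax : ∀ y ∈ Λ, toLex y ≤ toLex x₀)
    (hcorner : ∀ i : Fin 2, x₀ - unitVec i ∈ Λ) {ℓw : ℕ} (hΛ : Λ ⊆ halfOpenBox 2 ℓw)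
    {ι : Type*} (sι : Finset ι) (Sw : ι → Finset (Site 2)) (hS : ∀ i, Sw i ⊆ Λ) (zw : ι → Site 2)
    (hzw : ∀ i, shiftSet (zw i) (Sw i) ⊆ Λ) {O : ∀ i, FermionOp (Sw i)} (hO : ∀ i ∈ sι, (O i).IsHermitian)
    (g : ι → ℝ) {LB : FermionOp (Λ.erase x₀)} (hLB : LB.IsHermitian) {c : ℝ}
    (hcert : ((Real.exp c : ℂ) • cfc Real.exp LB -
      fermionPartialTrace (PolySite.incl (Finset.erase_subset x₀ Λ))
        (cfc Real.exp (-((βh : ℂ) • (cornerEnergyRep Λ x₀ t U₀ μ + windowAnnihilator sι Λ Sw hS zw hzw O g)) +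
          fermionEmbed (PolySite.incl (Finset.erase_subset x₀ Λ)) LB))).PosSemidef)
    {eup : ℝ} (he : energyDensityTT' t t' U n ≤ eup) :
    ω.meanEnergy (hubbardTTPrimeFermionInteraction t t' U) 1 ≤
      ((((c + βh * (U₀ - 2 * μ)) - βh * (U₀ - μ) * n) + βh * |t'| * (16 / Real.pi ^ 2)) +
        βh * max (U₀ - U) 0 * (n / 2) + β * eup) / (β - βh) :=
  h.meanEnergy_hubbardTTPrime_le_of_hot_anchorU_kinematic_of_energyDensityTT'_le hU0 hn0 hn2 U₀ hLs hβh hlt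
    (eventually_log_partitionFn_sector_le_of_cornerMarkovCertificate_particleHole_tPrimeTransport hn0 hn2 t t' U₀ hβh hLs μ
      hx₀ hmax hcorner hΛ sι Sw hS zw hzw hO g hLB hcert) he

/-- **Rectangle corollary, free above the anchor** (`Λ = rectWindow a' b'`, corner `(a' − 1, b' − 1)`, `a', b' ≥ 2` — the shape
of the programme's claim nodes): the REFLECTED transported rectangle C1 at `(β_h, μ, U₁)`, `U₁ ≤ U`, `T = 0` row at `U` ⇒
`e_Φ(ω) ≤ (((c + β_h(U₁ − 2μ)) − β_h(U₁ − μ)n) + β_h |t'| 16/π² + β e⁺)/(β − β_h)`.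
[cite: PoulinHastings2011, eqs. (3)–(8)] [cite: LiebPRL1989, proof of Theorem 2] [cite: Lieb1973, §V (5.2)–(5.4)] -/
theorem IsTorusLimitOfMixture.meanEnergy_hubbardTTPrime_le_of_rectMarkovCertificate_particleHole_tPrimeTransport_left_U_of_energyDensityTT'_le
    (hU0 : 0 ≤ U) (hn0 : 0 ≤ n) (hn2 : n < 2) {U₁ : ℝ} (hU1 : U₁ ≤ U)
    (h : ω.IsTorusLimitOfMixture (sectorGibbsCount n) (fun L => sectorGibbsWeightTT' β t t' U n L)
      (fun L => sectorGibbsVectorTT' t t' U n L) Ls)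
    (hLs : Tendsto Ls atTop atTop) {βh : ℝ} (hβh : 0 < βh) (hlt : βh < β)
    (μ : ℝ) {a' b' : ℕ} (ha' : 2 ≤ a') (hb' : 2 ≤ b')
    {ι : Type*} (sι : Finset ι) (Sw : ι → Finset (Site 2)) (hS : ∀ i, Sw i ⊆ rectWindow a' b') (zw : ι → Site 2)
    (hzw : ∀ i, shiftSet (zw i) (Sw i) ⊆ rectWindow a' b') {O : ∀ i, FermionOp (Sw i)}
    (hO : ∀ i ∈ sι, (O i).IsHermitian) (g : ι → ℝ)
    {LB : FermionOp ((rectWindow a' b').erase (mkSite2 (a' - 1) (b' - 1)))} (hLB : LB.IsHermitian) {c : ℝ}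
    (hcert : ((Real.exp c : ℂ) • cfc Real.exp LB -
      fermionPartialTrace (PolySite.incl (Finset.erase_subset (mkSite2 (a' - 1) (b' - 1)) (rectWindow a' b')))
        (cfc Real.exp (-((βh : ℂ) • (cornerEnergyRep (rectWindow a' b') (mkSite2 (a' - 1) (b' - 1)) t U₁ μ +
            windowAnnihilator sι (rectWindow a' b') Sw hS zw hzw O g)) +
          fermionEmbed (PolySite.incl (Finset.erase_subset (mkSite2 (a' - 1) (b' - 1)) (rectWindow a' b'))) LB))).PosSemidef)
    {eup : ℝ} (he : energyDensityTT' t t' U n ≤ eup) :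
    ω.meanEnergy (hubbardTTPrimeFermionInteraction t t' U) 1 ≤
      ((((c + βh * (U₁ - 2 * μ)) - βh * (U₁ - μ) * n) + βh * |t'| * (16 / Real.pi ^ 2)) + β * eup) / (β - βh) :=
  h.meanEnergy_hubbardTTPrime_le_of_cornerMarkovCertificate_particleHole_tPrimeTransport_left_U_of_energyDensityTT'_le hU0 hn0
    hn2 hU1 hLs hβh hlt μ (rectCorner_mem_rectWindow (by omega) (by omega)) toLex_le_toLex_rectCorner
    (rectCorner_sub_unitVec_mem_rectWindow ha' hb') (rectWindow_subset_halfOpenBox_max a' b') sι Sw hS zw hzw hO g hLB hcert he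

/-- **Rectangle corollary, one anchor `U₀`, kinematic below** (`Λ = rectWindow a' b'`, `a', b' ≥ 2`):
`e_Φ(ω) ≤ (((c + β_h(U₀ − 2μ)) − β_h(U₀ − μ)n) + β_h |t'| 16/π² + β_h·max(U₀ − U, 0)·n/2 + β e⁺)/(β − β_h)`.
[cite: PoulinHastings2011, eqs. (3)–(8)] [cite: LiebPRL1989, proof of Theorem 2] [cite: Lieb1973, §V (5.2)–(5.4)] -/
theorem IsTorusLimitOfMixture.meanEnergy_hubbardTTPrime_le_of_rectMarkovCertificate_particleHole_tPrimeTransport_anchorU_kinematic_of_energyDensityTT'_le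
    (hU0 : 0 ≤ U) (hn0 : 0 ≤ n) (hn2 : n < 2) (U₀ : ℝ)
    (h : ω.IsTorusLimitOfMixture (sectorGibbsCount n) (fun L => sectorGibbsWeightTT' β t t' U n L)
      (fun L => sectorGibbsVectorTT' t t' U n L) Ls)
    (hLs : Tendsto Ls atTop atTop) {βh : ℝ} (hβh : 0 < βh) (hlt : βh < β)
    (μ : ℝ) {a' b' : ℕ} (ha' : 2 ≤ a') (hb' : 2 ≤ b')
    {ι : Type*} (sι : Finset ι) (Sw : ι → Finset (Site 2)) (hS : ∀ i, Sw i ⊆ rectWindow a' b') (zw : ι → Site 2)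
    (hzw : ∀ i, shiftSet (zw i) (Sw i) ⊆ rectWindow a' b') {O : ∀ i, FermionOp (Sw i)}
    (hO : ∀ i ∈ sι, (O i).IsHermitian) (g : ι → ℝ)
    {LB : FermionOp ((rectWindow a' b').erase (mkSite2 (a' - 1) (b' - 1)))} (hLB : LB.IsHermitian) {c : ℝ}
    (hcert : ((Real.exp c : ℂ) • cfc Real.exp LB -
      fermionPartialTrace (PolySite.incl (Finset.erase_subset (mkSite2 (a' - 1) (b' - 1)) (rectWindow a' b')))
        (cfc Real.exp (-((βh : ℂ) • (cornerEnergyRep (rectWindow a' b') (mkSite2 (a' - 1) (b' - 1)) t U₀ μ +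
            windowAnnihilator sι (rectWindow a' b') Sw hS zw hzw O g)) +
          fermionEmbed (PolySite.incl (Finset.erase_subset (mkSite2 (a' - 1) (b' - 1)) (rectWindow a' b'))) LB))).PosSemidef)
    {eup : ℝ} (he : energyDensityTT' t t' U n ≤ eup) :
    ω.meanEnergy (hubbardTTPrimeFermionInteraction t t' U) 1 ≤
      ((((c + βh * (U₀ - 2 * μ)) - βh * (U₀ - μ) * n) + βh * |t'| * (16 / Real.pi ^ 2)) +
        βh * max (U₀ - U) 0 * (n / 2) + β * eup) / (β - βh) :=
  h.meanEnergy_hubbardTTPrime_le_of_cornerMarkovCertificate_particleHole_tPrimeTransport_anchorU_kinematic_of_energyDensityTT'_le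
    hU0 hn0 hn2 U₀ hLs hβh hlt μ (rectCorner_mem_rectWindow (by omega) (by omega)) toLex_le_toLex_rectCorner
    (rectCorner_sub_unitVec_mem_rectWindow ha' hb') (rectWindow_subset_halfOpenBox_max a' b') sι Sw hS zw hzw hO g hLB hcert he

end InfVolFermionState

end Literature.MathematicalPhysics.QuantumLattice
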